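import Summits.QuantumFields.YangMills.Theorems.CurvatureKernelBound.Negative.FreeKernel

/-!
# `CurvatureKernelBound` — negative lemmas V: order-insufficiency core (dressed free two-point functionals)

Supports crux item `stmt-QuantumFields-11687` (`PencilRigidity.CurvatureKernelBound`: for every compact simple
`G`, `r`, `sch` and one-species `S₁` carrying the curvature package `W₁`, the two-point function of `S₁` on `⁰𝒮`
is integration against a REAL kernel `K(x₀ − x₁)`, continuous off `0`, with `|K x| ≤ C (1 + ‖x‖^(η−10))`,
`η > 0`). Standing disprover's negative lemmas (refuter, cdisprove); no conclusion below asserts a Theses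
statement positively.

§G. For a two-point functional of the form `T = T₀ ∘ L` — `T₀ F = ∫ G_m(u₀ − u₁) F(u) du` the free two-point
functional and `L` a continuous operator on test functions of dilation degree `−8`
(`L (F(·/s)) = s⁻⁸ (L F)(·/s)`) preserving supports off the diagonal — the `⁰𝒮`-dilations satisfy
`s_j² T(F_{s_j}) → ∫ (4π²‖u₀ − u₁‖²)⁻¹ (L F)(u) du` (`tendsto_sq_mul_integral_G_dil`, from part IV), so by the
UV-scaling criterion of part II such a `T` admits NO kernel with the crux's bound as soon as ONE massless moment
`∫ (4π²‖u₀−u₁‖²)⁻¹ (L F₀) ≠ 0` (`not_representable_of_masslessMoment_ne_zero`). §G' the canonical dressing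
`L₈ = Σ_μ ∂_{(0,μ)}⁸` as a continuous operator (`D8`, `L8`, `L8_dil`, `L8_supp`) and the reduction
`not_representable_T0_L8` of the witness to one number. [folklore]
-/

open scoped BigOperators Topology SchwartzMap
open MeasureTheory Filter Set
open Literature.MathematicalPhysics.QuantumLattice Literature.MathematicalPhysics.AQFT
  Literature.MathematicalPhysics.QuantumFieldTheory

noncomputable section

namespace Summit.QuantumFields.YangMills.Theorems.CurvatureKernelBound.Negative

/-! ## §G Order-insufficiency CORE: functionals `T = T₀ ∘ L` (dressed free two-point functions) -/

section Core

open Real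
open scoped LineDeriv

/-- `G_m ≥ 0`. -/
theorem FreeKernel.G_nonneg (m : ℝ) (x : E4) : 0 ≤ FreeKernel.G m x :=
  setIntegral_nonneg measurableSet_Ioi fun _ ht =>
    mul_nonneg (Real.exp_pos _).le (Literature.Analysis.UnboundedOperators.heatKernel_pos (mem_Ioi.1 ht) x).le

/-- `G_m` is strongly measurable. -/
theorem FreeKernel.stronglyMeasurable_G (m : ℝ) : StronglyMeasurable (FreeKernel.G m) := by
  have hmeas : Measurable fun p : E4 × ℝ =>
      Real.exp (-m ^ 2 * p.2) * Literature.Analysis.UnboundedOperators.heatKernel p.2 p.1 := by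
    unfold Literature.Analysis.UnboundedOperators.heatKernel; fun_prop
  exact hmeas.stronglyMeasurable.integral_prod_right' (ν := volume.restrict (Ioi (0 : ℝ)))

/-- The massless kernel `(4π²‖w‖²)⁻¹` as a function of the relative coordinate. -/
def masslessWeight (u : Fin 2 → E4) : ℝ := 1 / (4 * π ^ 2 * ‖u 0 - u 1‖ ^ 2)

/-- The massless weight is measurable. [folklore] -/
theorem measurable_masslessWeight : Measurable masslessWeight := by
  unfold masslessWeight; fun_prop

/-- **Rescaled free two-point integrals converge to the massless moment at rate `O(s)`.** -/
theorem norm_sq_integral_G_dil_sub_le {m : ℝ} (hm : 0 < m) (Ψ : 𝓢((Fin 2 → E4), ℂ)) {δ : ℝ}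
    (hδ : 0 < δ) (hsep : ∀ u, Ψ u ≠ 0 → δ ≤ ‖u 0 - u 1‖) {s : ℝ} (hs : 0 < s) :
    ‖((s ^ 2 : ℝ) : ℂ) * (∫ u, (FreeKernel.G m (s • (u 0 - u 1)) : ℂ) * Ψ u) -
        ∫ u, (masslessWeight u : ℂ) * Ψ u‖ ≤ m * s / (4 * π ^ 2 * δ) * ∫ u, ‖Ψ u‖ := by
  -- measurability
  have hmeasG : AEStronglyMeasurable
      (fun u : Fin 2 → E4 => (FreeKernel.G m (s • (u 0 - u 1)) : ℂ)) volume := by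
    have h1 : Measurable fun u : Fin 2 → E4 => s • (u 0 - u 1) := by fun_prop
    exact (Complex.continuous_ofReal.measurable.comp
      ((FreeKernel.stronglyMeasurable_G m).measurable.comp h1)).aestronglyMeasurable
  have hmeasW : AEStronglyMeasurable (fun u : Fin 2 → E4 => (masslessWeight u : ℂ)) volume :=
    (Complex.continuous_ofReal.measurable.comp measurable_masslessWeight).aestronglyMeasurable
  -- pointwise bounds on the support
  have hw0 : ∀ u, Ψ u ≠ 0 → u 0 - u 1 ≠ 0 := fun u hu h0 => by
    have := hsep u hu; rw [h0, norm_zero] at this; linarith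
  have hGb : ∀ u, ‖(FreeKernel.G m (s • (u 0 - u 1)) : ℂ) * Ψ u‖ ≤
      1 / (4 * π ^ 2 * (s * δ) ^ 2) * ‖Ψ u‖ := by
    intro u
    by_cases hu : Ψ u = 0
    · simp [hu]
    have hw := hw0 u hu
    rw [norm_mul, Complex.norm_real, Real.norm_of_nonneg (FreeKernel.G_nonneg _ _)]
    refine mul_le_mul_of_nonneg_right ?_ (norm_nonneg _)
    have h1 := FreeKernel.G_le (m := m) (smul_ne_zero hs.ne' hw)
    rw [norm_smul, Real.norm_of_nonneg hs.le] at h1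
    refine h1.trans ?_
    have : s * δ ≤ s * ‖u 0 - u 1‖ := mul_le_mul_of_nonneg_left (hsep u hu) hs.le
    have hsd : 0 < s * δ := by positivity
    gcongr
  have hWb : ∀ u, ‖(masslessWeight u : ℂ) * Ψ u‖ ≤ 1 / (4 * π ^ 2 * δ ^ 2) * ‖Ψ u‖ := by
    intro u
    by_cases hu : Ψ u = 0
    · simp [hu]
    rw [norm_mul, Complex.norm_real, Real.norm_of_nonneg (by unfold masslessWeight; positivity)]
    refine mul_le_mul_of_nonneg_right ?_ (norm_nonneg _)
    unfold masslessWeight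
    have := hsep u hu
    gcongr
  have hintG : Integrable (fun u : Fin 2 → E4 => (FreeKernel.G m (s • (u 0 - u 1)) : ℂ) * Ψ u) :=
    Integrable.mono' ((Ψ.integrable.norm).const_mul _) (hmeasG.mul Ψ.continuous.aestronglyMeasurable)
      (Eventually.of_forall hGb)
  have hintW : Integrable (fun u : Fin 2 → E4 => (masslessWeight u : ℂ) * Ψ u) :=
    Integrable.mono' ((Ψ.integrable.norm).const_mul _) (hmeasW.mul Ψ.continuous.aestronglyMeasurable)
      (Eventually.of_forall hWb)
  -- the difference, pointwise
  have hpt : ∀ u, ‖((s ^ 2 : ℝ) : ℂ) * ((FreeKernel.G m (s • (u 0 - u 1)) : ℂ) * Ψ u) -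
      (masslessWeight u : ℂ) * Ψ u‖ ≤ m * s / (4 * π ^ 2 * δ) * ‖Ψ u‖ := by
    intro u
    by_cases hu : Ψ u = 0
    · simp [hu]
    have hw := hw0 u hu
    have hfac : ((s ^ 2 : ℝ) : ℂ) * ((FreeKernel.G m (s • (u 0 - u 1)) : ℂ) * Ψ u) -
        (masslessWeight u : ℂ) * Ψ u =
        ((s ^ 2 * FreeKernel.G m (s • (u 0 - u 1)) - masslessWeight u : ℝ) : ℂ) * Ψ u := by
      push_cast; ring
    rw [hfac, norm_mul, Complex.norm_real, Real.norm_eq_abs]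
    refine mul_le_mul_of_nonneg_right ?_ (norm_nonneg _)
    have h := FreeKernel.abs_sq_mul_G_smul_sub_le hm hw hs
    unfold masslessWeight
    refine h.trans ?_
    have := hsep u hu
    have hmspos : 0 ≤ m * s := by positivity
    gcongr
  rw [← integral_const_mul, ← integral_sub (hintG.const_mul _) hintW]
  calc ‖∫ u, ((s ^ 2 : ℝ) : ℂ) * ((FreeKernel.G m (s • (u 0 - u 1)) : ℂ) * Ψ u) -
          (masslessWeight u : ℂ) * Ψ u‖
      ≤ ∫ u, ‖((s ^ 2 : ℝ) : ℂ) * ((FreeKernel.G m (s • (u 0 - u 1)) : ℂ) * Ψ u) -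
          (masslessWeight u : ℂ) * Ψ u‖ := norm_integral_le_integral_norm _
    _ ≤ ∫ u, m * s / (4 * π ^ 2 * δ) * ‖Ψ u‖ :=
        integral_mono_of_nonneg (Eventually.of_forall fun _ => norm_nonneg _)
          ((Ψ.integrable.norm).const_mul _) (Eventually.of_forall hpt)
    _ = m * s / (4 * π ^ 2 * δ) * ∫ u, ‖Ψ u‖ := integral_const_mul _ _

/-- … hence `s_j² ∫ G_m(s_j w) Ψ → ∫ (4π²‖w‖²)⁻¹ Ψ` along any `s_j → 0⁺`. -/
theorem tendsto_sq_mul_integral_G_dil {m : ℝ} (hm : 0 < m) (Ψ : 𝓢((Fin 2 → E4), ℂ)) {δ : ℝ}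
    (hδ : 0 < δ) (hsep : ∀ u, Ψ u ≠ 0 → δ ≤ ‖u 0 - u 1‖) {s : ℕ → ℝ} (hs : ∀ j, 0 < s j)
    (hs0 : Tendsto s atTop (𝓝 0)) :
    Tendsto (fun j => ((s j ^ 2 : ℝ) : ℂ) * ∫ u, (FreeKernel.G m (s j • (u 0 - u 1)) : ℂ) * Ψ u)
      atTop (𝓝 (∫ u, (masslessWeight u : ℂ) * Ψ u)) := by
  rw [tendsto_iff_norm_sub_tendsto_zero]
  refine squeeze_zero (fun _ => norm_nonneg _)
    (fun j => norm_sq_integral_G_dil_sub_le hm Ψ hδ hsep (hs j)) ?_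
  have h : Tendsto (fun j => m * s j / (4 * π ^ 2 * δ) * ∫ u, ‖Ψ u‖) atTop
      (𝓝 (m * 0 / (4 * π ^ 2 * δ) * ∫ u, ‖Ψ u‖)) :=
    ((tendsto_const_nhds.mul hs0).div_const _).mul tendsto_const_nhds
  simpa using h

/-- **Order-insufficiency core.** Let `T` be a two-point functional of the form
`T F = ∫ G_m(u₀-u₁) (L F)(u) du`, `L` a continuous linear operator on two-point test functions
which is homogeneous of degree `-8` under dilations and does not enlarge supports (e.g.
`L = Σ_μ ∂_{(0,μ)}⁸`, §G'). If the MASSLESS MOMENT `J(F₀) = ∫ (4π²‖u₀-u₁‖²)⁻¹ (L F₀)(u) du` of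
ONE off-diagonal `F₀` with `δ ≤ ‖u₀-u₁‖ ≤ R` on its support is nonzero, then `T` admits NO
kernel with the crux's bound (any `η > 0`): `s² T(F₀,s) → J(F₀) ≠ 0` against §B. What is left
for `¬ CurvatureKernelBoundWithoutLatticeSixteen` at the two-point level is bookkeeping (the
package properties of `T`) plus ONE explicit eighth derivative (`J ≠ 0`). -/
theorem not_representable_of_masslessMoment_ne_zero {m : ℝ} (hm : 0 < m) (T : TwoPointCLM)
    (L : 𝓢((Fin 2 → E4), ℂ) →L[ℂ] 𝓢((Fin 2 → E4), ℂ))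
    (hT : ∀ F, T F = ∫ u, (FreeKernel.G m (u 0 - u 1) : ℂ) * L F u)
    (hL_dil : ∀ (s : ℝ) (hs : 0 < s) (F : 𝓢((Fin 2 → E4), ℂ)),
      L (dil s hs.ne' F) = (s⁻¹ ^ 8 : ℝ) • dil s hs.ne' (L F))
    (hL_supp : ∀ (F : 𝓢((Fin 2 → E4), ℂ)) (u : Fin 2 → E4), L F u ≠ 0 →
      u ∈ tsupport (F : (Fin 2 → E4) → ℂ))
    {F₀ : 𝓢((Fin 2 → E4), ℂ)} (hF₀ : IsOffDiagonal F₀) {δ R : ℝ} (hδ : 0 < δ)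
    (hsep : ∀ u ∈ tsupport (F₀ : (Fin 2 → E4) → ℂ), δ ≤ ‖u 0 - u 1‖ ∧ ‖u 0 - u 1‖ ≤ R)
    (hJ : ∫ u, (masslessWeight u : ℂ) * L F₀ u ≠ 0) :
    ¬ ∃ (K : E4 → ℝ) (C η : ℝ), KernelData K C η ∧ RepresentsCLM T K := by
  -- the dilation sequence `s_j = 1/(j+1)`
  set s : ℕ → ℝ := fun j => ((j : ℝ) + 1)⁻¹ with hsdef
  have hs : ∀ j, 0 < s j := fun j => by positivity
  have hs0 : Tendsto s atTop (𝓝 0) :=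
    tendsto_inv_atTop_zero.comp (tendsto_natCast_atTop_atTop.atTop_add tendsto_const_nhds)
  have hsepF : ∀ u, F₀ u ≠ 0 → δ ≤ ‖u 0 - u 1‖ ∧ ‖u 0 - u 1‖ ≤ R :=
    fun u hu => hsep u (subset_tsupport _ hu)
  have hsepL : ∀ u, L F₀ u ≠ 0 → δ ≤ ‖u 0 - u 1‖ := fun u hu => (hsep u (hL_supp F₀ u hu)).1
  refine not_representsCLM_of_dilation_blowup T hF₀ hδ hsepF hs hs0 fun hlim => ?_
  -- `T (F₀)_s = ∫ G_m(s w) (L F₀)`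
  have hTdil : ∀ j, T (dil (s j) (hs j).ne' F₀) =
      ∫ u, (FreeKernel.G m (s j • (u 0 - u 1)) : ℂ) * L F₀ u := by
    intro j
    rw [hT, hL_dil (s j) (hs j)]
    have h1 : (fun u : Fin 2 → E4 => (FreeKernel.G m (u 0 - u 1) : ℂ) *
        (((s j)⁻¹ ^ 8 : ℝ) • dil (s j) (hs j).ne' (L F₀)) u) =
        fun u => (((s j)⁻¹ ^ 8 : ℝ) : ℂ) *
          ((FreeKernel.G m (u 0 - u 1) : ℂ) * dil (s j) (hs j).ne' (L F₀) u) := by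
      funext u
      rw [smul_apply, Complex.real_smul]
      ring
    rw [h1, integral_const_mul, integral_kernel_dil (FreeKernel.G m) (L F₀) (hs j),
      Complex.real_smul, ← mul_assoc]
    have hc : (((s j)⁻¹ ^ 8 : ℝ) : ℂ) * ((s j ^ 8 : ℝ) : ℂ) = 1 := by
      rw [← Complex.ofReal_mul, ← mul_pow, inv_mul_cancel₀ (hs j).ne', one_pow, Complex.ofReal_one]
    rw [hc, one_mul]
  -- the limit of `s² T(F₀,s)` is the massless moment
  have h1 := tendsto_sq_mul_integral_G_dil hm (L F₀) hδ hsepL hs hs0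
  have h2 : Tendsto (fun j => s j ^ 2 * ‖T (dil (s j) (hs j).ne' F₀)‖) atTop
      (𝓝 ‖∫ u, (masslessWeight u : ℂ) * L F₀ u‖) := by
    refine h1.norm.congr' (Eventually.of_forall fun j => ?_)
    show ‖((s j ^ 2 : ℝ) : ℂ) * ∫ u, (FreeKernel.G m (s j • (u 0 - u 1)) : ℂ) * L F₀ u‖ =
      s j ^ 2 * ‖T (dil (s j) (hs j).ne' F₀)‖
    rw [norm_mul, Complex.norm_real, Real.norm_of_nonneg (by positivity), hTdil j]
  exact hJ (norm_eq_zero.1 (tendsto_nhds_unique h2 hlim))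

end Core

/-! ## §G' The canonical dressing `L₈ = Σ_μ ∂_{(0,μ)}⁸` (degree `-8`, support-preserving) -/

section Dressing

open scoped LineDeriv

/-- The direction `e_μ` in slot `0` of a two-point configuration. -/
def V0 (μ : Fin 4) : Fin 2 → E4 := Pi.single 0 (EuclideanSpace.single μ 1)

/-- `∂_{(0,μ)}⁸` as a continuous linear operator on two-point test functions. -/
def D8 (μ : Fin 4) : 𝓢((Fin 2 → E4), ℂ) →L[ℂ] 𝓢((Fin 2 → E4), ℂ) :=
  LineDeriv.iteratedLineDerivOpCLM ℂ (𝓢((Fin 2 → E4), ℂ)) (fun _ : Fin 8 => V0 μ)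

/-- The dressing `L₈ = Σ_μ ∂_{(0,μ)}⁸` (symbol `Σ_μ k_μ⁸` on slot `0`; against `G_m(u₀-u₁)` it acts
like the symmetric `Σ_μ ∂_{(0,μ)}⁴∂_{(1,μ)}⁴`). -/
def L8 : 𝓢((Fin 2 → E4), ℂ) →L[ℂ] 𝓢((Fin 2 → E4), ℂ) := ∑ μ : Fin 4, D8 μ

/-- Unfolding `D8 μ` as the eighth iterated line derivative along `V0 μ`. [folklore] -/
theorem D8_apply (μ : Fin 4) (F : 𝓢((Fin 2 → E4), ℂ)) :
    D8 μ F = ∂^{fun _ : Fin 8 => V0 μ} F := rfl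

/-- Unfolding `L8` as the sum of the four `D8 μ`. [folklore] -/
theorem L8_apply (F : 𝓢((Fin 2 → E4), ℂ)) : L8 F = ∑ μ : Fin 4, D8 μ F := by
  simp [L8]

/-- Chain rule under dilation for one line derivative. -/
theorem lineDerivOp_dil (v : Fin 2 → E4) {s : ℝ} (hs : s ≠ 0) (F : 𝓢((Fin 2 → E4), ℂ)) :
    ∂_{v} (dil s hs F) = s⁻¹ • dil s hs (∂_{v} F) := by
  have hg : (ContinuousLinearEquiv.smulLeft (Units.mk0 s hs)⁻¹ : (Fin 2 → E4) ≃L[ℝ] (Fin 2 → E4))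
      v = s⁻¹ • v := by
    show ((Units.mk0 s hs)⁻¹ : ℝˣ) • v = s⁻¹ • v
    rw [Units.smul_def, Units.val_inv_eq_inv_val, Units.val_mk0]
  change ∂_{v} (SchwartzMap.compCLMOfContinuousLinearEquiv ℂ
    (ContinuousLinearEquiv.smulLeft (Units.mk0 s hs)⁻¹ : (Fin 2 → E4) ≃L[ℝ] (Fin 2 → E4)) F) = _
  rw [SchwartzMap.lineDerivOp_compCLMOfContinuousLinearEquiv, hg,
    LineDerivLeftSMul.lineDerivOp_left_smul, ContinuousLinearMap.map_smul_of_tower]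
  rfl

/-- … and for the iterated derivative along a fixed direction. -/
theorem iteratedLineDerivOp_dil (v : Fin 2 → E4) {s : ℝ} (hs : s ≠ 0) (n : ℕ)
    (F : 𝓢((Fin 2 → E4), ℂ)) :
    ∂^{fun _ : Fin n => v} (dil s hs F) = (s⁻¹ ^ n : ℝ) • dil s hs (∂^{fun _ : Fin n => v} F) := by
  induction n with
  | zero => simp
  | succ n ih =>
    rw [LineDeriv.iteratedLineDerivOp_succ_left, LineDeriv.iteratedLineDerivOp_succ_left]
    have htail : (Fin.tail fun _ : Fin (n + 1) => v) = fun _ : Fin n => v := rfl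
    rw [htail, ih]
    show ∂_{v} ((s⁻¹ ^ n : ℝ) • dil s hs (∂^{fun _ : Fin n => v} F)) =
      (s⁻¹ ^ (n + 1) : ℝ) • dil s hs (∂_{v} (∂^{fun _ : Fin n => v} F))
    rw [LineDerivSMul.lineDerivOp_smul, lineDerivOp_dil, smul_smul, pow_succ]

/-- `D8 μ` has dilation degree `-8`. [folklore] -/
theorem D8_dil (μ : Fin 4) {s : ℝ} (hs : s ≠ 0) (F : 𝓢((Fin 2 → E4), ℂ)) :
    D8 μ (dil s hs F) = (s⁻¹ ^ 8 : ℝ) • dil s hs (D8 μ F) := by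
  rw [D8_apply, D8_apply, iteratedLineDerivOp_dil]

/-- `L₈` is homogeneous of degree `-8` under dilations. -/
theorem L8_dil (s : ℝ) (hs : 0 < s) (F : 𝓢((Fin 2 → E4), ℂ)) :
    L8 (dil s hs.ne' F) = (s⁻¹ ^ 8 : ℝ) • dil s hs.ne' (L8 F) := by
  rw [L8_apply, L8_apply, map_sum, Finset.smul_sum]
  exact Finset.sum_congr rfl fun μ _ => D8_dil μ hs.ne' F

/-- `L₈` does not enlarge supports. -/
theorem L8_supp (F : 𝓢((Fin 2 → E4), ℂ)) (u : Fin 2 → E4) (hu : L8 F u ≠ 0) :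
    u ∈ tsupport (F : (Fin 2 → E4) → ℂ) := by
  rw [L8_apply, sum_apply] at hu
  obtain ⟨μ, -, hμ⟩ := Finset.exists_ne_zero_of_sum_ne_zero hu
  rw [D8_apply] at hμ
  exact SchwartzMap.tsupport_iteratedLineDerivOp_subset (fun _ : Fin 8 => V0 μ) F
    (subset_tsupport _ hμ)

/-- **The canonical witness functional, conditional form.** For ANY two-point functional agreeing
with `F ↦ ∫ G_m(u₀-u₁) (L₈F)(u) du` (the two-point function of the Gaussian family with covariance
`(Σ_μ k_μ⁸)/(k²+m²)` of §D, restricted to test functions), non-representability with the crux's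
bound follows from ONE number: the massless moment `∫ (4π²‖u₀-u₁‖²)⁻¹ (L₈F₀)(u) du ≠ 0` of one
separated off-diagonal `F₀` (blueprint: eight Schwartz integrations by parts —
`SchwartzMap.integral_mul_lineDerivOp_right_eq_neg_left` against a compactly supported smooth
extension of `(4π²‖w‖²)⁻¹` from a neighbourhood of `tsupport F₀` — turn it into
`∫ H(u₀-u₁) F₀` with `4π² H = Σ_μ ∂_μ⁸ ‖w‖⁻²`, `4π² H(e₁) = 483840`; take `F₀ ≥ 0` a bump tensor at
`(e₁, 0)`). -/
theorem not_representable_T0_L8 {m : ℝ} (hm : 0 < m) (T : TwoPointCLM)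
    (hT : ∀ F, T F = ∫ u, (FreeKernel.G m (u 0 - u 1) : ℂ) * L8 F u)
    {F₀ : 𝓢((Fin 2 → E4), ℂ)} (hF₀ : IsOffDiagonal F₀) {δ R : ℝ} (hδ : 0 < δ)
    (hsep : ∀ u ∈ tsupport (F₀ : (Fin 2 → E4) → ℂ), δ ≤ ‖u 0 - u 1‖ ∧ ‖u 0 - u 1‖ ≤ R)
    (hJ : ∫ u, (masslessWeight u : ℂ) * L8 F₀ u ≠ 0) :
    ¬ ∃ (K : E4 → ℝ) (C η : ℝ), KernelData K C η ∧ RepresentsCLM T K :=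
  not_representable_of_masslessMoment_ne_zero hm T L8 hT L8_dil L8_supp hF₀ hδ hsep hJ

end Dressing

end Summit.QuantumFields.YangMills.Theorems.CurvatureKernelBound.Negative
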